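import Mathlib.Analysis.SpecialFunctions.Pow.Real
import Literature.Probability.Percolation.VoronoiCrossing
import Literature.Topology.PlaneTopology.JordanSweepParity
import HarnessLib

/-!
# Tassion's arm estimates for critical Poisson–Voronoi percolation (annealed, mesh-uniform)

Topic: Probability / Percolation.  Two NAMED FACTS (published theorems not yet proved in the tree)
on critical planar Voronoi percolation, in the vocabulary of `VoronoiCrossing.lean`: the nuclei
are two independent Poisson point processes `PB`, `PW` of Lebesgue intensity on `ℂ`
(`IsPoissonPointProcess volume`, `PoissonPointProcess.lean`; a configuration is
`c = (B, W) : PointConfig ℂ × PointConfig ℂ` under `PB.prod PW`), a point `w` is *black at mesh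
`δ`* iff `w / δ ∈ blackRegion B W` (at least as close to a black nucleus as to a white one; ties
are both colours, Bollobás–Riordan, *Percolation* (2006), Ch. 8 §8.1), and a *black path* is a
continuous path of black points.  This is Tassion's self-dual model at `p = 1/2` (V. Tassion,
*Crossing probabilities for Voronoi percolation*, Ann. Probab. 44 (2016) 3385–3398,
arXiv:1410.6773, §1: `X` a Poisson process of intensity `1`, each point black with probability
`p` independently, i.e. `(X_b, X_w)` two independent Poisson processes of intensities `p`, `1 - p`;
at `p = 1/2` ours is the image under `w ↦ √2 · w`, which only changes constants), read at scale
`1/δ`: by scaling, an event about black points at mesh `δ` in a window of size `ε` is Tassion's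
event at scale `s = ε/δ`, and "mesh-uniform for `δ ≤ ε`" is Tassion's "for all `s ≥ 1`".

* `VoronoiAnnealedOneArm` (F1) — **Theorem 3 (2)** of Tassion 2016: at `p = 1/2` there is `η > 0`
  with `π₁(s, t) ≤ (s/t)^η` for all `1 ≤ s < t`, `π₁(s, t)` the probability of a black path from
  `Λ_s = [-s, s]²` to `∂Λ_t`.  Stated with discs: the probability of a black path from
  `B̄(z, ε)` to `{dist · z ≥ ρ}` at mesh `δ ≤ ε ≤ ρ` is `≤ C (ε/ρ)^η`, uniformly in `z ∈ ℂ`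
  (translation invariance) — discs/squares and the case `ε/ρ > 1/√2` only change `C`.
* `VoronoiAnnealedBlackCircuit` (F2) — the **black-circuit estimate of §4** (proof of Theorem 3
  (2)): with `c > 0` from Theorem 1 (RSW: `inf_{s ≥ 1} f_s(ρ) > 0`) and quasi-independence
  (Lemma 1.1, Cor. 1.3), "there exists a black circuit in `A_{s,t}` with probability larger than
  `1 - (1 - c)^{⌊log₅(t/s)⌋}`", a *circuit* in the annulus `A_{s,t} = Λ_t ∖ Λ_s` being (§1.1) a
  Jordan curve in `A_{s,t}` surrounding the origin, *black* if all its points are black.  Stated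
  with round annuli `{r < dist · p < ρ}` (which contain `A_{r, ρ'}`, `ρ' < ρ/√2`), Jordan curve =
  `IsJordanLoop` with the centre in `IsJordanLoop.inside` (`JordanSweepParity.lean`), and the
  geometric bound rewritten as `C (r/ρ)^η`.

Both are GENUINE debts: proving them means formalising Tassion's paper (RSW Theorem 1 by the
renormalisation of §§2–3; FKG and quasi-independence for Voronoi percolation = Bollobás–Riordan
Ch. 8 Lemmas 14 and 18; the circuit construction of §4, with the extraction of a Jordan circuit
from black crossings of the a.s. polygonal black region).  They are the two RSW-grade inputs of
the approximate equicontinuity of annealed Voronoi separating probabilities in a Jordan domain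
(Bollobás–Riordan Ch. 7, proof of Claim 22, p. 198, continuum version).

Non-vacuity.  The hypotheses are satisfiable: Poisson processes of Lebesgue intensity exist
(`existsUnique_isPoissonPointProcess_holds`, `PoissonPointProcessExistence.lean`), and then
`PB.prod PW` is a probability measure, so `(PB.prod PW).real E ≤ 1` for every event; the
constants must satisfy `C ≥ 1` (take `ε = ρ` in F1) and the content is the decay as
`ε/ρ → 0` (resp. `r/ρ → 0`), uniformly in the mesh `δ ≤ ε` (resp. `δ ≤ r`) and in the centre.
`Measure.real` of a possibly non-measurable set is the outer measure, bounded by the probability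
of Tassion's (measurable) event containing it.  No junk values: `δ > 0` throughout, real powers
of the positive ratio `ε/ρ ∈ (0, 1]`.

Proved here: the qualitative corollaries `VoronoiAnnealedOneArm.exists_radius`,
`VoronoiAnnealedBlackCircuit.exists_radius` ("for `β > 0`, `ρ > 0` there is an inner radius making
the probability `≤ β` for all meshes `δ` below it, uniformly in the centre"), via
`exists_radius_of_powerBound`.  Deliberately NOT here: RSW itself (Theorem 1), the box-crossing
property (Theorem 3 (1)), quenched versions (Ahlberg–Griffiths–Morris–Tassion 2016).

## References
* V. Tassion, *Crossing probabilities for Voronoi percolation*, Ann. Probab. 44 (5) (2016)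
  3385–3398, doi:10.1214/15-AOP1052, arXiv:1410.6773 — Thm 1, Thm 3, §1.1, §4. [Tassion2016]
* B. Bollobás, O. Riordan, *Percolation*, CUP (2006), Ch. 8 §§8.1–8.3 (model, FKG Lemma 14,
  locality Lemma 18), Ch. 7 p. 198. [BollobasRiordan2006]
-/

namespace Literature.Probability.Percolation

open _root_.MeasureTheory _root_.Filter _root_.Set _root_.Metric
open scoped _root_.Topology
open Literature.Analysis.FunctionSpaces
open Literature.Topology.PlaneTopology

/-! ### The two named facts -/

/-- **Tassion's one-arm bound for critical Poisson–Voronoi percolation, annealed and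
mesh-uniform (F1).**  For two independent Poisson processes `PB`, `PW` of Lebesgue intensity
(black and white nuclei) there are `C` and `η > 0` such that for all meshes `0 < δ ≤ ε` and radii
`ε ≤ ρ` and every centre `z`, the probability that some path `γ` from a point `a` with
`dist a z ≤ ε` to a point `b` with `dist b z ≥ ρ` consists of points black at mesh `δ`
(`γ t / δ ∈ blackRegion B W`) is at most `C (ε/ρ)^η`.  This is Theorem 3 (2) of Tassion (2016),
"`π₁(s,t) ≤ (s/t)^η` for `1 ≤ s < t`" at `p = 1/2`, after scaling by `1/δ` (`s = ε/δ ≥ 1`,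
`t = ρ/(√2 δ)`), translation, and discs in place of squares (constants only).
[cite: Tassion2016, Thm 3 (2)] -/
def VoronoiAnnealedOneArm : Prop :=
  ∀ (PB PW : Measure (PointConfig ℂ)),
    IsPoissonPointProcess (volume : Measure ℂ) PB → IsPoissonPointProcess (volume : Measure ℂ) PW →
    ∃ C η : ℝ, 0 < η ∧ ∀ (δ ε ρ : ℝ), 0 < δ → δ ≤ ε → ε ≤ ρ → ∀ z : ℂ,
      (PB.prod PW).real {c | ∃ (a b : ℂ) (γ : Path a b), dist a z ≤ ε ∧ ρ ≤ dist b z ∧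
        ∀ t, (γ t : ℂ) / (δ : ℂ) ∈ blackRegion (c.1 : Set ℂ) (c.2 : Set ℂ)} ≤ C * (ε / ρ) ^ η

/-- **Black circuits in annuli for critical Poisson–Voronoi percolation, annealed and mesh-uniform
(F2).**  For two independent Poisson processes `PB`, `PW` of Lebesgue intensity there are `C` and
`η > 0` such that for all `0 < δ ≤ r < ρ` and every centre `p`, the probability that NO Jordan
curve `Γ` (`IsJordanLoop Γ`) with `p` in its inside runs in the open annulus
`{r < dist · p < ρ}` through points black at mesh `δ` only, is at most `C (r/ρ)^η`.  This is the
estimate displayed in §4 of Tassion (2016) (proof of Theorem 3 (2)): "there exists a black circuit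
in `A_{s,t}` with probability larger than `1 - (1-c)^{⌊log₅(t/s)⌋}`", `c > 0` the RSW constant of
Theorem 1 combined with quasi-independence (Lemma 1.1), a circuit being a Jordan curve in the
annulus surrounding its centre (§1.1); square annuli `A_{r,ρ'} ⊆ {r < dist · p < ρ}` for
`ρ' < ρ/√2`, scaling by `1/δ` (`s = r/δ ≥ 1`) and `(1-c)^{⌊log₅ x⌋} ≤ C x^{-η}` give this form.
[cite: Tassion2016, §4 (proof of Thm 3 (2))] -/
def VoronoiAnnealedBlackCircuit : Prop :=
  ∀ (PB PW : Measure (PointConfig ℂ)),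
    IsPoissonPointProcess (volume : Measure ℂ) PB → IsPoissonPointProcess (volume : Measure ℂ) PW →
    ∃ C η : ℝ, 0 < η ∧ ∀ (δ r ρ : ℝ), 0 < δ → δ ≤ r → r < ρ → ∀ p : ℂ,
      (PB.prod PW).real {c | ¬ ∃ Γ : ℝ → ℂ, IsJordanLoop Γ ∧ p ∈ IsJordanLoop.inside Γ ∧
        ∀ t, r < dist (Γ t) p ∧ dist (Γ t) p < ρ ∧
          Γ t / (δ : ℂ) ∈ blackRegion (c.1 : Set ℂ) (c.2 : Set ℂ)} ≤ C * (r / ρ) ^ η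

/-! ### Qualitative corollaries (proved) -/

/-- Choice of the inner radius in a power-law bound: given `C` and `η, β, ρ > 0` there is
`ε ∈ (0, ρ)` with `C (ε/ρ)^η ≤ β`. [folklore] -/
theorem exists_radius_of_powerBound (C : ℝ) {η β ρ : ℝ} (hη : 0 < η) (hβ : 0 < β) (hρ : 0 < ρ) :
    ∃ ε ∈ Set.Ioo (0 : ℝ) ρ, C * (ε / ρ) ^ η ≤ β := by
  rcases le_or_gt C 0 with hC | hC
  · refine ⟨ρ / 2, ⟨by positivity, by linarith⟩, ?_⟩
    have : 0 ≤ (ρ / 2 / ρ) ^ η := Real.rpow_nonneg (by positivity) η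
    nlinarith
  · set x : ℝ := (β / C) ^ (1 / η) with hx
    have hx0 : 0 < x := Real.rpow_pos_of_pos (div_pos hβ hC) _
    set m : ℝ := min (1 / 2) x with hm
    have hm0 : 0 < m := lt_min one_half_pos hx0
    have hm1 : m ≤ 1 / 2 := min_le_left _ _
    refine ⟨ρ * m, ⟨by positivity, by nlinarith⟩, ?_⟩
    rw [mul_div_cancel_left₀ _ hρ.ne']
    have h1 : m ^ η ≤ x ^ η := Real.rpow_le_rpow hm0.le (min_le_right _ _) hη.le
    have h2 : x ^ η = β / C := by
      rw [hx, ← Real.rpow_mul (div_pos hβ hC).le, one_div_mul_cancel hη.ne', Real.rpow_one]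
    calc C * m ^ η ≤ C * x ^ η := by gcongr
      _ = β := by rw [h2, mul_div_cancel₀ _ hC.ne']

/-- **F1, qualitative form**: under `VoronoiAnnealedOneArm`, for `β > 0` and `ρ > 0` there is
`ε ∈ (0, ρ)` such that, for all small meshes `δ > 0` (namely `δ ≤ ε`) and all centres `z`, a
black arm from `B̄(z, ε)` to `{dist · z ≥ ρ}` has probability `≤ β`. [cite: Tassion2016, Thm 3 (2)] -/
theorem VoronoiAnnealedOneArm.exists_radius (h : VoronoiAnnealedOneArm)
    {PB PW : Measure (PointConfig ℂ)} (hB : IsPoissonPointProcess (volume : Measure ℂ) PB)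
    (hW : IsPoissonPointProcess (volume : Measure ℂ) PW) {β : ℝ} (hβ : 0 < β) {ρ : ℝ} (hρ : 0 < ρ) :
    ∃ ε ∈ Set.Ioo (0 : ℝ) ρ, ∀ᶠ δ : ℝ in 𝓝[>] 0, ∀ z : ℂ,
      (PB.prod PW).real {c | ∃ (a b : ℂ) (γ : Path a b), dist a z ≤ ε ∧ ρ ≤ dist b z ∧
        ∀ t, (γ t : ℂ) / (δ : ℂ) ∈ blackRegion (c.1 : Set ℂ) (c.2 : Set ℂ)} ≤ β := by
  obtain ⟨C, η, hη, hbound⟩ := h PB PW hB hW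
  obtain ⟨ε, ⟨hε0, hερ⟩, hle⟩ := exists_radius_of_powerBound C hη hβ hρ
  refine ⟨ε, ⟨hε0, hερ⟩, ?_⟩
  filter_upwards [Ioc_mem_nhdsGT hε0] with δ hδ
  intro z
  exact (hbound δ ε ρ hδ.1 hδ.2 hερ.le z).trans hle

/-- **F2, qualitative form**: under `VoronoiAnnealedBlackCircuit`, for `β > 0` and `ρ > 0` there
is `r ∈ (0, ρ)` such that, for all small meshes `δ > 0` (namely `δ ≤ r`) and all centres `p`, the
absence of a black Jordan circuit around `p` in `{r < dist · p < ρ}` has probability `≤ β`.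
[cite: Tassion2016, §4 (proof of Thm 3 (2))] -/
theorem VoronoiAnnealedBlackCircuit.exists_radius (h : VoronoiAnnealedBlackCircuit)
    {PB PW : Measure (PointConfig ℂ)} (hB : IsPoissonPointProcess (volume : Measure ℂ) PB)
    (hW : IsPoissonPointProcess (volume : Measure ℂ) PW) {β : ℝ} (hβ : 0 < β) {ρ : ℝ} (hρ : 0 < ρ) :
    ∃ r ∈ Set.Ioo (0 : ℝ) ρ, ∀ᶠ δ : ℝ in 𝓝[>] 0, ∀ p : ℂ,
      (PB.prod PW).real {c | ¬ ∃ Γ : ℝ → ℂ, IsJordanLoop Γ ∧ p ∈ IsJordanLoop.inside Γ ∧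
        ∀ t, r < dist (Γ t) p ∧ dist (Γ t) p < ρ ∧
          Γ t / (δ : ℂ) ∈ blackRegion (c.1 : Set ℂ) (c.2 : Set ℂ)} ≤ β := by
  obtain ⟨C, η, hη, hbound⟩ := h PB PW hB hW
  obtain ⟨r, ⟨hr0, hrρ⟩, hle⟩ := exists_radius_of_powerBound C hη hβ hρ
  refine ⟨r, ⟨hr0, hrρ⟩, ?_⟩
  filter_upwards [Ioc_mem_nhdsGT hr0] with δ hδ
  intro p
  exact (hbound δ r ρ hδ.1 hδ.2 hrρ p).trans hle

end Literature.Probability.Percolation
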